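import Summits.Ventures.HSemireg.WedgePointPairPowers
import Summits.Ventures.HSemireg.WedgeSurfacePowersPerQ

/-!
# Venture HSemireg — per-`q` blocks of the `n`-fold box of `m`-dimensional point pairs, 1/4: the LOCAL MODEL on ONE block
# (local targets, the canonical local sources `Opt m`, local classification, local `q`) — the `Fin 4` tables of
# `WedgeSurfacePowersPerQ.lean` (surfaces, `m = 2`, by `decide`) as THEOREMS for every `m ≥ 1`

HONEST FRAMING. Part of the Lean index of the computation cell `pub-hsemireg` (seat p10 gen 3, Sunday typer «UNIFORM-IN-n»).
Finite-dimensional EXTERIOR ALGEBRA over a field (and integer polynomial arithmetic) ONLY: no variety, no cohomology theory, no sheaf, no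
Ext group, no semiregularity map is constructed here; nothing here says that HC / HC_CM / HC_AV holds; no Literature fact is declared or
used.  Custodian versions: STRUCTURE.md v1.0-SIGNED 9b196a05977dd067 (§1.1 C10 / C13), theory/FORMULA-N.md PART A §4.1″ (th-6), PART B (th-7).

THE MODEL (`WedgePointPairPowers.lean`): one block = `2m` letters `Fin (m+m)`, halves `X` (letters `< m`; dictionary: `H⁰(T)`-type
directions) and `Y` (dictionary: `H¹(𝒪)`), the point pair `a·E_X + c·E_Y` (th-7's `WedgePair.pointPair`).  THIS FILE, in the generic
wedge model `Wedge.B K (Fin (m+m))`: the local image `E_t ∧ (a E_X + c E_Y) = a·u(t,X)·E_{t⊔X} + c·u(t,Y)·E_{t⊔Y}` (`B_mul_pp`) and its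
support = the LOCAL TARGETS `ltg m t` (`coord_B_mul_pp_ne_zero_iff`, `m ≥ 1`, `a, c ≠ 0`); the CANONICAL local sources
`optSet m = 𝒫(X) ∪ {t ⊆ Y : 0 < |t| < m}` (`Opt m`; one per source class: `local_trichotomy` / `local_class` — every local image is
`0` (the source meets both halves) or a multiple of the image of a canonical source of the same degree, `E_Y ∧ f ∝ E_X ∧ f`);
local `q` (`lq` = number of `X` letters missing; `lqf` = fixed part `m − |t|` for a non-empty `X`-source, else `0`; `lq_of_mem_ltg`:
a target of a canonical source has `q` = fixed part, `+m` exactly for the target `Y` of the empty source); «a local target determines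
the class» (`opt_eq_of_mem_ltg`); default targets (`ltgt_mem_ltg`), `Ys_mem_ltg_empty`, `lz`.  DICTIONARY quoted, NOT asserted.
Namespace `Summit.Ventures.HSemireg.Wedge.PairPowers`, new names only.
-/

open Module Set Set.powersetCard

namespace Summit.Ventures.HSemireg.Wedge.PairPowers

open Summit.Ventures.HSemireg.Wedge Summit.Ventures.HSemireg.Wedge.Kunneth

variable (K : Type*) [Field K] (m : ℕ)

/-- the `X` half (letters `< m`; dictionary: `H⁰(T)`-type directions). -/
abbrev Xs : Finset (Fin (m + m)) := WedgePair.Xset m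

/-- the `Y` half (letters `≥ m`; dictionary: `H¹(𝒪)`-type directions). -/
abbrev Ys : Finset (Fin (m + m)) := WedgePair.Yset m

/-- the point pair is `a·E_X + c·E_Y`. -/
lemma pp_eq (a c : K) : pp K m a c = a • B K (Fin (m + m)) (Xs m) + c • B K (Fin (m + m)) (Ys m) := rfl

/-- `E_t ∧ (a E_X + c E_Y) = a·u(t,X)·E_{t ∪ X} + c·u(t,Y)·E_{t ∪ Y}`. -/
lemma B_mul_pp (a c : K) (t : Finset (Fin (m + m))) :
    B K (Fin (m + m)) t * pp K m a c =
      (a * u K t (Xs m)) • B K (Fin (m + m)) (t ∪ Xs m) + (c * u K t (Ys m)) • B K (Fin (m + m)) (t ∪ Ys m) := by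
  rw [pp_eq, mul_add, mul_smul_comm, mul_smul_comm, B_mul_B, B_mul_B, smul_smul, smul_smul]

/-- the local coordinates of `E_t ∧ (a E_X + c E_Y)`. -/
lemma coord_B_mul_pp (a c : K) (t T : Finset (Fin (m + m))) :
    (B K (Fin (m + m))).coord T (B K (Fin (m + m)) t * pp K m a c) =
      (if t ∪ Xs m = T then a * u K t (Xs m) else 0) + (if t ∪ Ys m = T then c * u K t (Ys m) else 0) := by
  rw [B_mul_pp, map_add, map_smul, map_smul, SurfacePowers.coord_B, SurfacePowers.coord_B, smul_eq_mul, smul_eq_mul, mul_ite, mul_ite,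
    mul_one, mul_zero, mul_one, mul_zero]

/-- the LOCAL TARGETS of a local source `t`: `T = t ⊔ X` (`t` disjoint from `X`, the global component) or `T = t ⊔ Y` (`t` disjoint
from `Y`, the local component). -/
def ltg (t : Finset (Fin (m + m))) : Finset (Finset (Fin (m + m))) :=
  Finset.univ.filter fun T => (Disjoint t (Xs m) ∧ t ∪ Xs m = T) ∨ (Disjoint t (Ys m) ∧ t ∪ Ys m = T)

variable {m}

/-- membership in the local targets. -/
lemma mem_ltg {t T : Finset (Fin (m + m))} :
    T ∈ ltg m t ↔ (Disjoint t (Xs m) ∧ t ∪ Xs m = T) ∨ (Disjoint t (Ys m) ∧ t ∪ Ys m = T) := by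
  simp [ltg]

/-- `0 ∈ X`, `0 ∉ Y`: the two halves differ (`m ≥ 1`). -/
lemma Xs_ne_Ys (hm : 1 ≤ m) : Xs m ≠ Ys m := by
  intro h
  have h0 : (⟨0, by omega⟩ : Fin (m + m)) ∈ Xs m := by rw [WedgePair.mem_Xset]; exact hm
  rw [h, WedgePair.mem_Yset] at h0
  simp at h0
  omega

/-- a source disjoint from both halves is empty. -/
lemma eq_empty_of_disjoint {t : Finset (Fin (m + m))} (hX : Disjoint t (Xs m)) (hY : Disjoint t (Ys m)) : t = ∅ := by
  rw [Finset.eq_empty_iff_forall_notMem]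
  intro x hx
  rcases WedgePair.mem_X_or_Y m x with h | h
  · exact Finset.disjoint_left.mp hX hx h
  · exact Finset.disjoint_left.mp hY hx h

/-- the two components never coincide (`m ≥ 1`). -/
lemma not_hit_both (hm : 1 ≤ m) (t T : Finset (Fin (m + m))) :
    ¬ ((Disjoint t (Xs m) ∧ t ∪ Xs m = T) ∧ (Disjoint t (Ys m) ∧ t ∪ Ys m = T)) := by
  rintro ⟨⟨hX, hTX⟩, ⟨hY, hTY⟩⟩
  have ht := eq_empty_of_disjoint hX hY
  subst ht
  rw [Finset.empty_union] at hTX hTY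
  exact Xs_ne_Ys hm (hTX.trans hTY.symm)

variable {K}

/-- **local support**: for `a, c ≠ 0` (`m ≥ 1`), `E_T` occurs in `E_t ∧ (a E_X + c E_Y)` iff `T` is a local target of `t`. -/
theorem coord_B_mul_pp_ne_zero_iff (hm : 1 ≤ m) {a c : K} (ha : a ≠ 0) (hc : c ≠ 0) (t T : Finset (Fin (m + m))) :
    (B K (Fin (m + m))).coord T (B K (Fin (m + m)) t * pp K m a c) ≠ 0 ↔ T ∈ ltg m t := by
  rw [coord_B_mul_pp, mem_ltg]
  have h1 : (if t ∪ Xs m = T then a * u K t (Xs m) else 0) ≠ 0 ↔ Disjoint t (Xs m) ∧ t ∪ Xs m = T := by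
    split_ifs with h
    · rw [mul_ne_zero_iff, u_ne_zero_iff]; tauto
    · tauto
  have h2 : (if t ∪ Ys m = T then c * u K t (Ys m) else 0) ≠ 0 ↔ Disjoint t (Ys m) ∧ t ∪ Ys m = T := by
    split_ifs with h
    · rw [mul_ne_zero_iff, u_ne_zero_iff]; tauto
    · tauto
  have h12 := not_hit_both hm t T
  constructor
  · intro h
    by_contra hn
    rw [not_or, ← h1, ← h2, not_ne_iff, not_ne_iff] at hn
    rw [hn.1, hn.2, add_zero] at h
    exact h rfl
  · rintro (hX | hY)
    · have e2 : (if t ∪ Ys m = T then c * u K t (Ys m) else 0) = 0 := by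
        by_contra hne; exact h12 ⟨hX, h2.mp hne⟩
      rw [e2, add_zero]; exact h1.mpr hX
    · have e1 : (if t ∪ Xs m = T then a * u K t (Xs m) else 0) = 0 := by
        by_contra hne; exact h12 ⟨h1.mp hne, hY⟩
      rw [e1, zero_add]; exact h2.mpr hY

/-! ### The canonical local sources -/

variable (m)

/-- the CANONICAL local sources of an `m`-dimensional point-pair block (one per source class): the subsets of `X` (the empty source;
the `X`-sources with `1, …, m` letters, `q`-part `m − |t|` — `t = X` being the top collapse, also the class of `Y`) and the
NON-EMPTY PROPER subsets of `Y` (`q`-part `0`). -/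
def optSet : Finset (Finset (Fin (m + m))) :=
  (Xs m).powerset ∪ (Ys m).powerset.filter fun t => 0 < t.card ∧ t.card < m

/-- the type of canonical local sources. -/
abbrev Opt : Type := ↥(optSet m)

variable {m}

/-- membership in the canonical sources. -/
lemma mem_optSet {t : Finset (Fin (m + m))} : t ∈ optSet m ↔ t ⊆ Xs m ∨ (t ⊆ Ys m ∧ 0 < t.card ∧ t.card < m) := by
  simp [optSet]

variable (m)

/-- the empty source. -/
def oEmpty : Opt m := ⟨∅, mem_optSet.mpr (Or.inl (Finset.empty_subset _))⟩

/-- the top collapse `X`. -/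
def oTop : Opt m := ⟨Xs m, mem_optSet.mpr (Or.inl subset_rfl)⟩

variable {m}

/-- trichotomy of local sources: canonical, the half `Y` (class of `X`), or DEAD (meets both halves). -/
lemma local_trichotomy (t : Finset (Fin (m + m))) :
    t ∈ optSet m ∨ t = Ys m ∨ (¬ Disjoint t (Xs m) ∧ ¬ Disjoint t (Ys m)) := by
  rw [mem_optSet]
  by_cases hX : t ⊆ Xs m
  · exact Or.inl (Or.inl hX)
  · have hmY : ¬ Disjoint t (Ys m) := fun h => hX (WedgePair.disjoint_Y_iff_subset_X.mp h)
    by_cases hY : t ⊆ Ys m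
    · have hpos : 0 < t.card := by
        rw [Finset.card_pos]
        exact Finset.nonempty_of_ne_empty fun h => hX (h ▸ Finset.empty_subset _)
      rcases Nat.lt_or_ge t.card m with hlt | hge
      · exact Or.inl (Or.inr ⟨hY, hpos, hlt⟩)
      · right; left
        exact Finset.eq_of_subset_of_card_le hY (by rw [WedgePair.card_Yset]; exact hge)
    · exact Or.inr (Or.inr ⟨fun h => hY (WedgePair.disjoint_X_iff_subset_Y.mp h), hmY⟩)

/-- **local classification** (`m ≥ 1`, `c ≠ 0`): every local image `E_t ∧ (a E_X + c E_Y)` is `0` or a multiple of the image of a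
canonical source of the same degree (`E_Y ∧ f = a·u·E_{X⊔Y} ∝ E_X ∧ f = c·u′·E_{X⊔Y}`). -/
theorem local_class (hm : 1 ≤ m) {a c : K} (hc : c ≠ 0) (t : Finset (Fin (m + m))) :
    B K (Fin (m + m)) t * pp K m a c = 0 ∨
      ∃ o : Opt m, o.1.card = t.card ∧ ∃ μ : K, B K (Fin (m + m)) t * pp K m a c = μ • (B K (Fin (m + m)) o.1 * pp K m a c) := by
  rcases local_trichotomy t with h | rfl | ⟨hX, hY⟩
  · exact Or.inr ⟨⟨t, h⟩, rfl, 1, by rw [one_smul]⟩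
  · refine Or.inr ⟨oTop m, by rw [oTop, WedgePair.card_Xset, WedgePair.card_Yset], a * u K (Ys m) (Xs m) * (c * u K (Xs m) (Ys m))⁻¹, ?_⟩
    have hXY : Disjoint (Xs m) (Ys m) := WedgePair.disjoint_XY m
    have hXX : ¬ Disjoint (Xs m) (Xs m) := fun h => by
      have := eq_empty_of_disjoint h hXY
      have h0 : (⟨0, by omega⟩ : Fin (m + m)) ∈ Xs m := by rw [WedgePair.mem_Xset]; exact hm
      rw [this] at h0; simp at h0
    have hYY : ¬ Disjoint (Ys m) (Ys m) := fun h => by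
      have := eq_empty_of_disjoint hXY.symm h
      have h0 : (⟨m, by omega⟩ : Fin (m + m)) ∈ Ys m := by rw [WedgePair.mem_Yset]
      rw [this] at h0; simp at h0
    rw [oTop, B_mul_pp, B_mul_pp, u_eq_zero K hYY, u_eq_zero K hXX, mul_zero, zero_smul, add_zero, mul_zero, zero_smul,
      zero_add, smul_smul, Finset.union_comm (Ys m) (Xs m), inv_mul_cancel_right₀ (mul_ne_zero hc ((u_ne_zero_iff K).mpr hXY))]
  · left
    rw [B_mul_pp, u_eq_zero K hX, u_eq_zero K hY, mul_zero, mul_zero, zero_smul, zero_smul, add_zero]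

/-! ### Local `q`: targets of canonical sources -/

variable (m)

/-- the local `q` of a target monomial: the number of `X` letters it misses. -/
def lq (T : Finset (Fin (m + m))) : ℕ := (Xs m \ T).card

/-- the fixed `q`-part of a canonical source: `m − |t|` for a non-empty `X`-source, else `0`. -/
def lqf (o : Opt m) : ℕ := if o.1 ⊆ Xs m ∧ o.1 ≠ ∅ then m - o.1.card else 0

/-- the empty-block indicator. -/
def lz (o : Opt m) : ℕ := if o.1 = ∅ then 1 else 0

/-- the default local target of a canonical source. -/
def ltgt (o : Opt m) : Finset (Fin (m + m)) := if o.1 ⊆ Xs m then (if o.1 = ∅ then Xs m else o.1 ∪ Ys m) else o.1 ∪ Xs m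

variable {m}

/-- `X ∖ (t ∪ Y) = X ∖ t`. -/
lemma Xs_sdiff_union_Ys (t : Finset (Fin (m + m))) : Xs m \ (t ∪ Ys m) = Xs m \ t := by
  rw [Finset.sdiff_union_distrib, Finset.sdiff_eq_self_of_disjoint (WedgePair.disjoint_XY m),
    Finset.inter_eq_left.mpr Finset.sdiff_subset]

/-- **local `q` of a target of a canonical source** = fixed part, `+m` exactly for the target `Y` of the empty source. -/
theorem lq_of_mem_ltg (hm : 1 ≤ m) (o : Opt m) {T : Finset (Fin (m + m))} (hT : T ∈ ltg m o.1) :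
    lq m T = lqf m o + (if o.1 = ∅ ∧ T = Ys m then m else 0) := by
  rcases mem_ltg.mp hT with ⟨hd, rfl⟩ | ⟨hd, rfl⟩
  · -- global component: T = t ∪ X, no X letter missing
    rw [lq, Finset.sdiff_eq_empty_iff_subset.mpr Finset.subset_union_right, Finset.card_empty, lqf]
    by_cases h0 : o.1 = ∅
    · rw [if_neg (fun h => h.2 h0), h0, Finset.empty_union, if_neg (fun h => Xs_ne_Ys hm h.2)]
    · have hnX : ¬ (o.1 ⊆ Xs m ∧ o.1 ≠ ∅) := fun h =>
        h0 (eq_empty_of_disjoint hd (WedgePair.disjoint_Y_iff_subset_X.mpr h.1))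
      rw [if_neg hnX, if_neg (fun h => h0 h.1)]
  · -- local component: T = t ∪ Y, t ⊆ X
    have htX : o.1 ⊆ Xs m := WedgePair.disjoint_Y_iff_subset_X.mp hd
    rw [lq, Xs_sdiff_union_Ys, Finset.card_sdiff_of_subset htX, WedgePair.card_Xset, lqf]
    by_cases h0 : o.1 = ∅
    · rw [if_neg (fun h => h.2 h0), h0, Finset.card_empty, Finset.empty_union, if_pos ⟨rfl, rfl⟩]
      omega
    · rw [if_pos ⟨htX, h0⟩, if_neg (fun h => h0 h.1), add_zero]


/-- **a local target determines the canonical source** (`m ≥ 1`): distinct canonical classes have disjoint local supports. -/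
theorem opt_eq_of_mem_ltg (hm : 1 ≤ m) (o o' : Opt m) {T : Finset (Fin (m + m))} (h : T ∈ ltg m o.1) (h' : T ∈ ltg m o'.1) :
    o = o' := by
  have hYX : ¬ Ys m ⊆ Xs m := fun hs => by
    have hmem : (⟨m, by omega⟩ : Fin (m + m)) ∈ Ys m := by rw [WedgePair.mem_Yset]
    have := hs hmem
    rw [WedgePair.mem_Xset] at this
    simp at this
  -- a canonical source disjoint from `X` with `Y ⊆ it ∪ X` is impossible
  have key : ∀ p : Opt m, Disjoint p.1 (Xs m) → ¬ Ys m ⊆ p.1 ∪ Xs m := by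
    intro p hd hs
    have hsub : Ys m ⊆ p.1 := fun y hy => by
      rcases Finset.mem_union.mp (hs hy) with h1 | h1
      · exact h1
      · exact (Finset.disjoint_left.mp (WedgePair.disjoint_XY m) h1 hy).elim
    rcases mem_optSet.mp p.2 with hpX | ⟨-, -, hlt⟩
    · exact hYX (hsub.trans hpX)
    · have := Finset.card_le_card hsub
      rw [WedgePair.card_Yset] at this
      omega
  apply Subtype.ext
  rcases mem_ltg.mp h with ⟨hd, hT⟩ | ⟨hd, hT⟩ <;> rcases mem_ltg.mp h' with ⟨hd', hT'⟩ | ⟨hd', hT'⟩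
  · -- both global: o = T \ X = o'
    have e1 : o.1 = T \ Xs m := by rw [← hT, Finset.union_sdiff_cancel_right hd]
    have e2 : o'.1 = T \ Xs m := by rw [← hT', Finset.union_sdiff_cancel_right hd']
    rw [e1, e2]
  · exact absurd (hT.symm ▸ hT' ▸ Finset.subset_union_right) (key o hd)
  · exact absurd (hT'.symm ▸ hT ▸ Finset.subset_union_right) (key o' hd')
  · have e1 : o.1 = T \ Ys m := by rw [← hT, Finset.union_sdiff_cancel_right hd]
    have e2 : o'.1 = T \ Ys m := by rw [← hT', Finset.union_sdiff_cancel_right hd']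
    rw [e1, e2]

/-- the default target is a target, of local `q` equal to the fixed part (`m ≥ 1`). -/
theorem ltgt_mem_ltg (hm : 1 ≤ m) (o : Opt m) : ltgt m o ∈ ltg m o.1 ∧ lq m (ltgt m o) = lqf m o := by
  have hmem : ltgt m o ∈ ltg m o.1 := by
    rw [mem_ltg, ltgt]
    by_cases hX : o.1 ⊆ Xs m
    · rw [if_pos hX]
      by_cases h0 : o.1 = ∅
      · rw [if_pos h0, h0]; left; exact ⟨Finset.disjoint_empty_left _, Finset.empty_union _⟩
      · rw [if_neg h0]; right; exact ⟨WedgePair.disjoint_Y_iff_subset_X.mpr hX, rfl⟩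
    · rw [if_neg hX]; left
      rcases mem_optSet.mp o.2 with h | ⟨hY, -, -⟩
      · exact absurd h hX
      · exact ⟨WedgePair.disjoint_X_iff_subset_Y.mpr hY, rfl⟩
  refine ⟨hmem, ?_⟩
  rw [lq_of_mem_ltg hm o hmem, ltgt]
  by_cases hX : o.1 ⊆ Xs m
  · rw [if_pos hX]
    by_cases h0 : o.1 = ∅
    · rw [if_pos h0, if_neg (fun h => Xs_ne_Ys hm h.2), add_zero]
    · rw [if_neg h0, if_neg (fun h => h0 h.1), add_zero]
  · rw [if_neg hX, if_neg, add_zero]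
    rintro ⟨h0, -⟩
    exact hX (h0 ▸ Finset.empty_subset _)

/-- the empty source also reaches `Y`, of local `q = m`. -/
theorem Ys_mem_ltg_empty : Ys m ∈ ltg m (oEmpty m).1 ∧ lq m (Ys m) = m ∧ (oEmpty m).1 = ∅ ∧ lqf m (oEmpty m) = 0 := by
  refine ⟨mem_ltg.mpr (Or.inr ⟨Finset.disjoint_empty_left _, Finset.empty_union _⟩), ?_, rfl, ?_⟩
  · rw [lq, Finset.sdiff_eq_self_of_disjoint (WedgePair.disjoint_XY m), WedgePair.card_Xset]
  · rw [lqf, if_neg]; exact fun h => h.2 rfl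

/-- `lz` is the indicator of the empty source. -/
lemma lz_eq (o : Opt m) : lz m o = (if o.1 = ∅ then 1 else 0) ∧ (o.1 = ∅ ↔ o = oEmpty m) :=
  ⟨rfl, ⟨fun h => Subtype.ext h, fun h => by rw [h]; rfl⟩⟩

/-- fixed part and empty indicator: at most one is non-zero, and the fixed part is `< m`... precisely `lqf o + m·lz o ≤ m`. -/
lemma lqf_add_lz_le (o : Opt m) : lqf m o + m * lz m o ≤ m := by
  rw [lqf, lz]
  by_cases h0 : o.1 = ∅
  · rw [if_neg (fun h => h.2 h0), if_pos h0]; omega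
  · rw [if_neg h0, mul_zero, add_zero]; split_ifs <;> omega

end Summit.Ventures.HSemireg.Wedge.PairPowers
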